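import Mathlib
import Summits.AtomisticToContinuum.Crystallization.Theorems.SquareWellLayerCakeStackingFaultSparsityExactLatticeLedgerBasics

/-!
# Exact-lattice ledger, II: reindexing, symmetry, rim shell sum, depth (helper file)

Crux `StackingFaultSparsity` (item stmt-AtomisticToContinuum-14296, routes `SquareWellLayerCake` /
`LaminarSixThreeThree`), line `Sketch`, stub `stub_exactLatticeLedger` (survey obligation M3c+e, the
exact-lattice ledger of the cylinder block flip; landing file
`SquareWellLayerCakeStackingFaultSparsityExactLatticeLedger.lean`, whose module docstring has the
overall map).

`ledger_reindex` (carrier): the enumerated window is parametrised by a finite index set `I ⊆ ℤ³`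
and `changedPairSum = ½ ∑_{q, q' ∈ I} Δ q q'`; `ledger_down_eq_up` (each changed pair is counted once,
from its lower layer); `rim_sum_le` (the rim shell sum about one site: partners laterally `≥ t` away
contribute `≤ 66000 max(t - 1, 1/2)⁻³`); `one_add_depth_le` (the window exceeds a disc site's reach
by `1 + depth`); `ledger_depth_sum` (depth summation over the disc of one layer,
`TriangularLayerCounts.sum_le_of_lateral_depth_bound` on the box).
-/

noncomputable section
namespace Summit.AtomisticToContinuum.Crystallization.Theorems.SquareWellLayerCake.StackingFaultSparsity
open Literature.MathematicalPhysics.StatisticalMechanics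

/-! ## 1. Reindexing the window by `ℤ³` -/

/-- **Reindexing.** The enumerated window `P` (injective, onto the stacking points within `R` of
the base point) is parametrised by the finite index set `I = {q ∈ ℤ³ : |barlowPos q - b| ≤ R}`;
the displacement `latticeShift` of `P i = barlowPos q` is `D q` (cylinder test on the index, the
chosen cylinder point being unique by injectivity of `barlowPos`), and the changed-pair sum is half
the full double sum of `Δ q q' = V(|new pair|) - V(|old pair|)` (`interactionEnergy_add_sub`,
`two_mul_interactionEnergy_eq_sum_sum`; pairs moved rigidly contribute `0`). [folklore] -/
theorem ledger_reindex :
    ∀ (a h : ℝ) (s : ℤ → ℤ) (q₁ q₂ i₀ j₀ : ℤ) (ρ R : ℝ) {N' : ℕ} (P : Fin N' → (EuclideanSpace ℝ (Fin 3)))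
      (D : ℤ × ℤ × ℤ → (EuclideanSpace ℝ (Fin 3))) (Δ : ℤ × ℤ × ℤ → ℤ × ℤ × ℤ → ℝ), 0 < a → 0 < h →
      (∀ q, InCyl a h s q₁ q₂ i₀ j₀ ρ q.1 q.2.1 q.2.2 →
        D q = ((shiftSign s q₁ q.1 : ℤ) : ℝ) • barlowOffset a) →
      (∀ q, ¬ InCyl a h s q₁ q₂ i₀ j₀ ρ q.1 q.2.1 q.2.2 → D q = 0) →
      (∀ q q', Δ q q' =
        lennardJones (dist (barlowPos a h s q.1 q.2.1 q.2.2 + D q)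
            (barlowPos a h s q'.1 q'.2.1 q'.2.2 + D q')) -
          lennardJones (dist (barlowPos a h s q.1 q.2.1 q.2.2)
            (barlowPos a h s q'.1 q'.2.1 q'.2.2))) →
      Function.Injective P →
      Set.range P = {p ∈ barlowStacking a h s | dist p (barlowPos a h s q₁ i₀ j₀) ≤ R} →
      ∃ I : Finset (ℤ × ℤ × ℤ),
        (∀ q, q ∈ I ↔ dist (barlowPos a h s q.1 q.2.1 q.2.2) (barlowPos a h s q₁ i₀ j₀) ≤ R) ∧
        changedPairSum lennardJones P (latticeShift a h s q₁ q₂ i₀ j₀ ρ P) =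
          1 / 2 * ∑ q ∈ I, ∑ q' ∈ I, Δ q q' := by
  intro a h s q₁ q₂ i₀ j₀ ρ R N' P D Δ ha hh hD₁ hD₀ hΔ hP hrange
  classical
  have hinj : Function.Injective fun q : ℤ × ℤ × ℤ => barlowPos a h s q.1 q.2.1 q.2.2 :=
    barlowPos_injective ha hh s
  have hmem : ∀ i, P i ∈ barlowStacking a h s ∧ dist (P i) (barlowPos a h s q₁ i₀ j₀) ≤ R := by
    intro i
    have hi : P i ∈ Set.range P := ⟨i, rfl⟩
    rw [hrange] at hi
    exact hi
  choose kf ef ff hPeq using fun i => (hmem i).1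
  set ι : Fin N' → ℤ × ℤ × ℤ := fun i => (kf i, ef i, ff i) with hιdef
  have hιP : ∀ i, barlowPos a h s (ι i).1 (ι i).2.1 (ι i).2.2 = P i := fun i => (hPeq i).symm
  have hιinj : Function.Injective ι := by
    intro i i' hii'
    apply hP
    rw [← hιP, ← hιP, hii']
  refine ⟨Finset.univ.image ι, fun q => ?_, ?_⟩
  · constructor
    · intro hq
      obtain ⟨i, -, rfl⟩ := Finset.mem_image.1 hq
      rw [hιP]
      exact (hmem i).2
    · intro hq
      have hq' : barlowPos a h s q.1 q.2.1 q.2.2 ∈ Set.range P := by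
        rw [hrange]
        exact ⟨⟨q.1, q.2.1, q.2.2, rfl⟩, hq⟩
      obtain ⟨i, hi⟩ := hq'
      have hιq : ι i = q := hinj (by simp only [hιP, hi])
      exact Finset.mem_image.2 ⟨i, Finset.mem_univ _, hιq⟩
  · -- the displacement on the index
    have hd : ∀ i, latticeShift a h s q₁ q₂ i₀ j₀ ρ P i = D (ι i) := by
      intro i
      by_cases hc : InCyl a h s q₁ q₂ i₀ j₀ ρ (ι i).1 (ι i).2.1 (ι i).2.2
      · rw [hD₁ _ hc]
        have hex : ∃ n i' j' : ℤ, InCyl a h s q₁ q₂ i₀ j₀ ρ n i' j' ∧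
            P i = barlowPos a h s n i' j' :=
          ⟨(ι i).1, (ι i).2.1, (ι i).2.2, hc, (hιP i).symm⟩
        obtain ⟨i', j', -, hPi⟩ := hex.choose_spec
        have hq : ((hex.choose, i', j') : ℤ × ℤ × ℤ) = ι i :=
          hinj (by simp only [hιP]; exact hPi.symm)
        have hc1 : hex.choose = (ι i).1 := congrArg Prod.fst hq
        simp only [latticeShift, dif_pos hex, hc1]
      · rw [hD₀ _ hc]
        have hnex : ¬ ∃ n i' j' : ℤ, InCyl a h s q₁ q₂ i₀ j₀ ρ n i' j' ∧
            P i = barlowPos a h s n i' j' := by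
          rintro ⟨n, i', j', hc', hPi⟩
          have hq : ((n, i', j') : ℤ × ℤ × ℤ) = ι i := hinj (by simp only [hιP]; exact hPi.symm)
          rw [← hq] at hc
          exact hc hc'
        simp only [latticeShift, dif_neg hnex]
    -- double sums along `ι`
    have hsum : ∀ F : ℤ × ℤ × ℤ → ℤ × ℤ × ℤ → ℝ,
        ∑ i, ∑ k, F (ι i) (ι k) =
          ∑ q ∈ Finset.univ.image ι, ∑ q' ∈ Finset.univ.image ι, F q q' := by
      intro F
      rw [Finset.sum_image fun i _ i' _ hii' => hιinj hii']
      refine Finset.sum_congr rfl fun i _ => ?_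
      rw [Finset.sum_image fun i _ i' _ hii' => hιinj hii']
    have hV0 : lennardJones 0 = 0 := lennardJones_zero
    have h2 := two_mul_interactionEnergy_eq_sum_sum lennardJones hV0
      (P + latticeShift a h s q₁ q₂ i₀ j₀ ρ P)
    have h1 := two_mul_interactionEnergy_eq_sum_sum lennardJones hV0 P
    have e2 : ∑ i, ∑ k, lennardJones (dist ((P + latticeShift a h s q₁ q₂ i₀ j₀ ρ P) i)
        ((P + latticeShift a h s q₁ q₂ i₀ j₀ ρ P) k)) =
        ∑ q ∈ Finset.univ.image ι, ∑ q' ∈ Finset.univ.image ι,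
          lennardJones (dist (barlowPos a h s q.1 q.2.1 q.2.2 + D q)
            (barlowPos a h s q'.1 q'.2.1 q'.2.2 + D q')) := by
      rw [← hsum]
      refine Finset.sum_congr rfl fun i _ => Finset.sum_congr rfl fun k _ => ?_
      simp only [Pi.add_apply, hd, hιP]
    have e1 : ∑ i, ∑ k, lennardJones (dist (P i) (P k)) =
        ∑ q ∈ Finset.univ.image ι, ∑ q' ∈ Finset.univ.image ι,
          lennardJones (dist (barlowPos a h s q.1 q.2.1 q.2.2)
            (barlowPos a h s q'.1 q'.2.1 q'.2.2)) := by
      rw [← hsum]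
      simp only [hιP]
    have e3 : ∑ q ∈ Finset.univ.image ι, ∑ q' ∈ Finset.univ.image ι, Δ q q' =
        (∑ q ∈ Finset.univ.image ι, ∑ q' ∈ Finset.univ.image ι,
          lennardJones (dist (barlowPos a h s q.1 q.2.1 q.2.2 + D q)
            (barlowPos a h s q'.1 q'.2.1 q'.2.2 + D q'))) -
        ∑ q ∈ Finset.univ.image ι, ∑ q' ∈ Finset.univ.image ι,
          lennardJones (dist (barlowPos a h s q.1 q.2.1 q.2.2)
            (barlowPos a h s q'.1 q'.2.1 q'.2.2)) := by
      simp only [hΔ, Finset.sum_sub_distrib]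
    rw [← interactionEnergy_add_sub lennardJones P _, e3, ← e1, ← e2, ← h1, ← h2]
    ring

/-! ## 2. Symmetry: pairs are counted from their lower layer -/

/-- **DOWN = UP.** The sum over the ordered pairs at layer gap `-K ≤ d ≤ -1` equals the sum over
the pairs at gap `1 ≤ d ≤ K` (swap the pair; `Δ` is symmetric). [folklore] -/
theorem ledger_down_eq_up (K : ℕ) (I : Finset (ℤ × ℤ × ℤ)) (Δ : ℤ × ℤ × ℤ → ℤ × ℤ × ℤ → ℝ)
    (hsymm : ∀ q q', Δ q q' = Δ q' q) :
    ∑ q ∈ I, ∑ q' ∈ I.filter (fun q' => 1 ≤ q.1 - q'.1 ∧ q.1 - q'.1 ≤ K), Δ q q' =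
      ∑ q ∈ I, ∑ q' ∈ I.filter (fun q' => 1 ≤ q'.1 - q.1 ∧ q'.1 - q.1 ≤ K), Δ q q' := by
  simp only [Finset.sum_filter]
  rw [Finset.sum_comm]
  refine Finset.sum_congr rfl fun q _ => Finset.sum_congr rfl fun q' _ => ?_
  rw [hsymm q' q]

/-- **The rim shell sum about one site.** For a centre index `c` and a finite set `T ∌ c` of partner
indices all at LATERAL distance `≥ t` from `c`, the old and the new pair terms satisfy
`∑_{q' ∈ T} (|V(|c_new - q'_new|)| + |V(|c - q'|)|) ≤ 66000 · max(t - 1, 1/2)⁻³`: both partner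
families are `1/2`-separated (`half_le_dist_disp`, `half_le_dist_old`), at distance `≥ 1/2` and
`≥ t - 6/5` (the displacements are laterally `≤ 3/5`) from the respective centre, so the two-scale
shell sum `sum_abs_lennardJones_le_two_scale` (`η = 1/2`, `ρ = max(t - 6/5, 1/2) ≥ (5/7) max(t - 1, 1/2)`)
applies. [folklore] -/
theorem rim_sum_le : ∀ K : ℕ, 2 ≤ K →
    ∀ (a h : ℝ) (s : ℤ → ℤ) (q₁ q₂ i₀ j₀ : ℤ) (ρ R : ℝ) (I : Finset (ℤ × ℤ × ℤ))
      (D : ℤ × ℤ × ℤ → (EuclideanSpace ℝ (Fin 3))) (Δ : ℤ × ℤ × ℤ → ℤ × ℤ × ℤ → ℝ),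
      InBox a h → IsHaggSeq s → q₁ < q₂ → (3 : ℤ) ∣ haggLabel s q₂ - haggLabel s q₁ → 1 ≤ ρ →
      ρ + ((q₂ : ℝ) - q₁) * h + K * h + 1 ≤ R →
      (∀ q, InCyl a h s q₁ q₂ i₀ j₀ ρ q.1 q.2.1 q.2.2 →
        D q = ((shiftSign s q₁ q.1 : ℤ) : ℝ) • barlowOffset a) →
      (∀ q, ¬ InCyl a h s q₁ q₂ i₀ j₀ ρ q.1 q.2.1 q.2.2 → D q = 0) →
      (∀ q q', Δ q q' =
        lennardJones (dist (barlowPos a h s q.1 q.2.1 q.2.2 + D q)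
            (barlowPos a h s q'.1 q'.2.1 q'.2.2 + D q')) -
          lennardJones (dist (barlowPos a h s q.1 q.2.1 q.2.2)
            (barlowPos a h s q'.1 q'.2.1 q'.2.2))) →
      (∀ q, q ∈ I ↔ dist (barlowPos a h s q.1 q.2.1 q.2.2) (barlowPos a h s q₁ i₀ j₀) ≤ R) →
      ∀ (c : ℤ × ℤ × ℤ) (T : Finset (ℤ × ℤ × ℤ)) (t : ℝ), c ∉ T →
        (∀ q' ∈ T, t ≤ √(latSq (barlowPos a h s c.1 c.2.1 c.2.2) (barlowPos a h s q'.1 q'.2.1 q'.2.2))) →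
        ∑ q' ∈ T, (|lennardJones (dist (barlowPos a h s c.1 c.2.1 c.2.2 + D c)
              (barlowPos a h s q'.1 q'.2.1 q'.2.2 + D q'))| +
            |lennardJones (dist (barlowPos a h s c.1 c.2.1 c.2.2)
              (barlowPos a h s q'.1 q'.2.1 q'.2.2))|) ≤
          66000 * (max (t - 1) (1 / 2))⁻¹ ^ 3 := by
  intro K hK a h s q₁ q₂ i₀ j₀ ρ R I D Δ hbox hs hq hcharge hρ hR hD₁ hD₀ hΔ hI c T t hcT ht
  classical
  obtain ⟨ha, hh⟩ := InBox.pos hbox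
  set L : ℝ := max (t - 6 / 5) (1 / 2) with hL
  have hL2 : 1 / 2 ≤ L := le_max_right _ _
  have hL1 : t - 6 / 5 ≤ L := le_max_left _ _
  have hL0 : 0 < L := by linarith
  have hconst : ((1 / 2 : ℝ)⁻¹ ^ 6 / 12 + 1 / 6) * (250 * (1 / 2 : ℝ)⁻¹ ^ 3 * L⁻¹ ^ 3) =
      11000 * L⁻¹ ^ 3 := by norm_num; ring
  -- new configuration
  have hnew : ∑ q' ∈ T, |lennardJones (dist (barlowPos a h s c.1 c.2.1 c.2.2 + D c)
      (barlowPos a h s q'.1 q'.2.1 q'.2.2 + D q'))| ≤ 11000 * L⁻¹ ^ 3 := by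
    have hinj : Set.InjOn (fun q' : ℤ × ℤ × ℤ => barlowPos a h s q'.1 q'.2.1 q'.2.2 + D q') (T : Set _) :=
      fun q' _ q'' _ hqq => disp_injective ha hh hD₁ hD₀ hqq
    rw [← Finset.sum_image (f := fun z => |lennardJones (dist (barlowPos a h s c.1 c.2.1 c.2.2 + D c) z)|)
      hinj, ← hconst]
    refine sum_abs_lennardJones_le_two_scale _ _ (by norm_num) hL2 ?_ ?_
    · intro z hz w hw hne
      obtain ⟨q', hq', rfl⟩ := Finset.mem_image.1 hz
      obtain ⟨q'', hq'', rfl⟩ := Finset.mem_image.1 hw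
      exact half_le_dist_disp hbox hD₁ hD₀ (fun h0 => hne (by rw [h0]))
    · intro z hz
      obtain ⟨q', hq', rfl⟩ := Finset.mem_image.1 hz
      have hne : c ≠ q' := fun h0 => hcT (h0 ▸ hq')
      refine max_le ?_ (half_le_dist_disp hbox hD₁ hD₀ hne)
      have h1 := ht q' hq'
      have h2 := sqrt_latSq_le_dist (barlowPos a h s c.1 c.2.1 c.2.2 + D c)
        (barlowPos a h s q'.1 q'.2.1 q'.2.2 + D q')
      have h3 := sqrt_latSq_triangle (barlowPos a h s c.1 c.2.1 c.2.2)
        (barlowPos a h s c.1 c.2.1 c.2.2 + D c) (barlowPos a h s q'.1 q'.2.1 q'.2.2 + D q')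
      have h4 := sqrt_latSq_triangle (barlowPos a h s c.1 c.2.1 c.2.2)
        (barlowPos a h s q'.1 q'.2.1 q'.2.2 + D q') (barlowPos a h s q'.1 q'.2.1 q'.2.2)
      have h5 : √(latSq (barlowPos a h s c.1 c.2.1 c.2.2) (barlowPos a h s c.1 c.2.1 c.2.2 + D c)) ≤
          3 / 5 := by
        rw [latSq_comm]; exact sqrt_latSq_disp_le hbox hD₁ hD₀ c _
      have h6 : √(latSq (barlowPos a h s q'.1 q'.2.1 q'.2.2 + D q') (barlowPos a h s q'.1 q'.2.1 q'.2.2)) ≤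
          3 / 5 := sqrt_latSq_disp_le hbox hD₁ hD₀ q' _
      linarith
  -- old configuration
  have hold : ∑ q' ∈ T, |lennardJones (dist (barlowPos a h s c.1 c.2.1 c.2.2)
      (barlowPos a h s q'.1 q'.2.1 q'.2.2))| ≤ 11000 * L⁻¹ ^ 3 := by
    have hinj : Set.InjOn (fun q' : ℤ × ℤ × ℤ => barlowPos a h s q'.1 q'.2.1 q'.2.2) (T : Set _) :=
      fun q' _ q'' _ hqq => barlowPos_injective ha hh s hqq
    rw [← Finset.sum_image (f := fun z => |lennardJones (dist (barlowPos a h s c.1 c.2.1 c.2.2) z)|)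
      hinj, ← hconst]
    refine sum_abs_lennardJones_le_two_scale _ _ (by norm_num) hL2 ?_ ?_
    · intro z hz w hw hne
      obtain ⟨q', hq', rfl⟩ := Finset.mem_image.1 hz
      obtain ⟨q'', hq'', rfl⟩ := Finset.mem_image.1 hw
      exact half_le_dist_old hbox s (fun h0 => hne (by rw [h0]))
    · intro z hz
      obtain ⟨q', hq', rfl⟩ := Finset.mem_image.1 hz
      have hne : c ≠ q' := fun h0 => hcT (h0 ▸ hq')
      refine max_le ?_ (half_le_dist_old hbox s hne)
      have h1 := ht q' hq'
      have h2 := sqrt_latSq_le_dist (barlowPos a h s c.1 c.2.1 c.2.2) (barlowPos a h s q'.1 q'.2.1 q'.2.2)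
      linarith
  -- compare `L` with `M = max (t - 1) (1/2)`
  set M : ℝ := max (t - 1) (1 / 2) with hM
  have hM0 : 0 < M := lt_of_lt_of_le (by norm_num) (le_max_right _ _)
  have hLM : 5 / 7 * M ≤ L := by
    have : M ≤ 7 / 5 * L := max_le (by linarith) (by linarith)
    linarith
  have hinv : L⁻¹ ^ 3 ≤ (343 / 125) * M⁻¹ ^ 3 := by
    have h1 : L⁻¹ ≤ (5 / 7 * M)⁻¹ := inv_anti₀ (by positivity) hLM
    have h2 : (5 / 7 * M)⁻¹ = 7 / 5 * M⁻¹ := by rw [mul_inv]; norm_num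
    rw [h2] at h1
    calc L⁻¹ ^ 3 ≤ (7 / 5 * M⁻¹) ^ 3 := pow_le_pow_left₀ (by positivity) h1 3
      _ = 343 / 125 * M⁻¹ ^ 3 := by ring
  rw [Finset.sum_add_distrib]
  have hM3 : 0 ≤ M⁻¹ ^ 3 := by positivity
  nlinarith [hnew, hold, hinv]

/-- **The window exceeds the disc sites' reach by `1 + depth`**: for a disc site `x` of a layer in
`[q₁ - K, q₂]` at depth `t = ρ - √latSq(x)`, every point beyond `R` from the base is at distance
`≥ 1 + t` from `x` (`|x - b| ≤ √latSq + (q₂ - q₁ + K) h - h` and `R ≥ ρ + (q₂ - q₁ + K) h + 1`).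
[folklore] -/
theorem one_add_depth_le : ∀ K : ℕ, 2 ≤ K →
    ∀ (a h : ℝ) (s : ℤ → ℤ) (q₁ q₂ i₀ j₀ : ℤ) (ρ R : ℝ) (I : Finset (ℤ × ℤ × ℤ))
      (D : ℤ × ℤ × ℤ → (EuclideanSpace ℝ (Fin 3))) (Δ : ℤ × ℤ × ℤ → ℤ × ℤ × ℤ → ℝ),
      InBox a h → IsHaggSeq s → q₁ < q₂ → (3 : ℤ) ∣ haggLabel s q₂ - haggLabel s q₁ → 1 ≤ ρ →
      ρ + ((q₂ : ℝ) - q₁) * h + K * h + 1 ≤ R →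
      (∀ q, InCyl a h s q₁ q₂ i₀ j₀ ρ q.1 q.2.1 q.2.2 →
        D q = ((shiftSign s q₁ q.1 : ℤ) : ℝ) • barlowOffset a) →
      (∀ q, ¬ InCyl a h s q₁ q₂ i₀ j₀ ρ q.1 q.2.1 q.2.2 → D q = 0) →
      (∀ q q', Δ q q' =
        lennardJones (dist (barlowPos a h s q.1 q.2.1 q.2.2 + D q)
            (barlowPos a h s q'.1 q'.2.1 q'.2.2 + D q')) -
          lennardJones (dist (barlowPos a h s q.1 q.2.1 q.2.2)
            (barlowPos a h s q'.1 q'.2.1 q'.2.2))) →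
      (∀ q, q ∈ I ↔ dist (barlowPos a h s q.1 q.2.1 q.2.2) (barlowPos a h s q₁ i₀ j₀) ≤ R) →
      ∀ q : ℤ × ℤ × ℤ, q.1 ∈ Finset.Icc (q₁ - K) q₂ → (latSq (barlowPos a h s q.1 q.2.1 q.2.2) (barlowPos a h s q₁ i₀ j₀) ≤ ρ ^ 2) →
        ∀ y : (EuclideanSpace ℝ (Fin 3)), R < dist y (barlowPos a h s q₁ i₀ j₀) →
          1 + (ρ - √(latSq (barlowPos a h s q.1 q.2.1 q.2.2) (barlowPos a h s q₁ i₀ j₀))) ≤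
            dist (barlowPos a h s q.1 q.2.1 q.2.2) y := by
  intro K hK a h s q₁ q₂ i₀ j₀ ρ R I D Δ hbox hs hq hcharge hρ hR hD₁ hD₀ hΔ hI q hm hdisc y hy
  obtain ⟨ha, hh⟩ := InBox.pos hbox
  rw [Finset.mem_Icc] at hm
  have hρ0 : 0 ≤ ρ := by linarith
  set ℓ := √(latSq (barlowPos a h s q.1 q.2.1 q.2.2) (barlowPos a h s q₁ i₀ j₀)) with hℓ
  have hℓ0 : 0 ≤ ℓ := Real.sqrt_nonneg _
  set V : ℝ := ((q₂ : ℝ) - q₁ + K) * h with hV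
  have hq' : (q₁ : ℝ) < q₂ := by exact_mod_cast hq
  have hK0 : (0 : ℝ) ≤ K := Nat.cast_nonneg K
  have hV0 : 0 ≤ V := mul_nonneg (by linarith) hh.le
  have hvert : |((q.1 : ℝ) - q₁) * h| ≤ V := by
    have h1 : |(q.1 : ℝ) - q₁| ≤ (q₂ : ℝ) - q₁ + K := by
      rw [abs_le]
      constructor
      · have : ((q₁ - K : ℤ) : ℝ) ≤ q.1 := by exact_mod_cast hm.1
        push_cast at this
        linarith
      · have : ((q.1 : ℤ) : ℝ) ≤ q₂ := by exact_mod_cast hm.2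
        linarith
    rw [abs_mul, abs_of_pos hh, hV]
    exact mul_le_mul_of_nonneg_right h1 hh.le
  -- `|x - b| ≤ ℓ + V`
  have hxb : dist (barlowPos a h s q.1 q.2.1 q.2.2) (barlowPos a h s q₁ i₀ j₀) ≤ ℓ + V := by
    have hsq : dist (barlowPos a h s q.1 q.2.1 q.2.2) (barlowPos a h s q₁ i₀ j₀) ^ 2 =
        ℓ ^ 2 + (((q.1 : ℝ) - q₁) * h) ^ 2 := by
      rw [hℓ, Real.sq_sqrt (by unfold latSq; positivity), EuclideanSpace.dist_sq_eq, Fin.sum_univ_three,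
        Real.dist_eq, Real.dist_eq, Real.dist_eq, sq_abs, sq_abs, sq_abs, latSq, barlowPos_apply_two,
        barlowPos_apply_two]
      ring
    have h2 : (((q.1 : ℝ) - q₁) * h) ^ 2 ≤ V ^ 2 := by
      have := hvert
      rw [abs_le] at this
      nlinarith
    have hle : dist (barlowPos a h s q.1 q.2.1 q.2.2) (barlowPos a h s q₁ i₀ j₀) ^ 2 ≤ (ℓ + V) ^ 2 := by
      rw [hsq]; nlinarith [mul_nonneg hℓ0 hV0]
    exact (pow_le_pow_iff_left₀ dist_nonneg (by positivity) two_ne_zero).1 hle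
  have htri := dist_triangle y (barlowPos a h s q.1 q.2.1 q.2.2) (barlowPos a h s q₁ i₀ j₀)
  rw [dist_comm y (barlowPos a h s q.1 q.2.1 q.2.2)] at htri
  have hR' : ρ + V + 1 ≤ R := by rw [hV]; nlinarith
  linarith

/-! ## 4. SAME-layer pairs (L4, rim within a layer) -/

/-- **Depth summation over the disc of one layer** (`TriangularLayerCounts.sum_le_of_lateral_depth_bound`
on the box: `4 (2ρ/a + 1)(1/a + 1) ≤ 26 ρ` for `a ≥ 47/50`, `ρ ≥ 1`): if `g ≤ A max(depth - t₀, 1/2)⁻³`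
on a set `S` of indices of the lateral disc of layer `n` (`depth = ρ - √latSq`), then
`∑_S g ≤ 26 (8 t₀ + 18) A ρ`. [folklore] -/
theorem ledger_depth_sum :
    ∀ (a h : ℝ) (s : ℤ → ℤ) (q₁ i₀ j₀ : ℤ) (ρ : ℝ) (n : ℤ) (t₀ A : ℝ) (S : Finset (ℤ × ℤ × ℤ))
      (g : ℤ × ℤ × ℤ → ℝ), 47 / 50 ≤ a → 1 ≤ ρ → 0 ≤ t₀ → 0 ≤ A →
      (∀ q ∈ S, q.1 = n ∧ (latSq (barlowPos a h s q.1 q.2.1 q.2.2) (barlowPos a h s q₁ i₀ j₀) ≤ ρ ^ 2)) →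
      (∀ q ∈ S, g q ≤ A * (max (ρ - √(latSq (barlowPos a h s q.1 q.2.1 q.2.2) (barlowPos a h s q₁ i₀ j₀)) - t₀)
        (1 / 2))⁻¹ ^ 3) →
      ∑ q ∈ S, g q ≤ 26 * (8 * t₀ + 18) * A * ρ := by
  intro a h s q₁ i₀ j₀ ρ n t₀ A S g ha hρ ht₀ hA hS hg
  classical
  have ha0 : 0 < a := by linarith
  have hρ0 : 0 ≤ ρ := by linarith
  -- project to the in-layer indices
  have hinj : Set.InjOn (fun q : ℤ × ℤ × ℤ => q.2) (S : Set (ℤ × ℤ × ℤ)) := by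
    intro q hq q' hq' hqq'
    have h1 := (hS q hq).1
    have h2 := (hS q' hq').1
    exact Prod.ext (h1.trans h2.symm) hqq'
  have hsum : ∑ q ∈ S, g q = ∑ ij ∈ S.image (fun q => q.2), g (n, ij) := by
    rw [Finset.sum_image hinj]
    refine Finset.sum_congr rfl fun q hq => ?_
    have h1 := (hS q hq).1
    rw [← h1]
  rw [hsum]
  have key := sum_le_of_lateral_depth_bound (h := h) s ha0 n (barlowPos a h s q₁ i₀ j₀) hρ0 ht₀ hA
    (S.image fun q => q.2) (fun ij hij => ?_) (fun ij => g (n, ij)) (fun ij hij => ?_)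
  · refine key.trans ?_
    have h1 : 2 * ρ / a + 1 ≤ 147 / 47 * ρ := by
      have : 2 * ρ / a ≤ 2 * ρ / (47 / 50) :=
        div_le_div_of_nonneg_left (by positivity) (by norm_num) ha
      have e : 2 * ρ / (47 / 50) = 100 / 47 * ρ := by ring
      linarith
    have h2 : 1 / a + 1 ≤ 97 / 47 := by
      have : 1 / a ≤ 1 / (47 / 50) := div_le_div_of_nonneg_left (by norm_num) (by norm_num) ha
      norm_num at this ⊢
      linarith
    have h3 : 4 * (2 * ρ / a + 1) * (1 / a + 1) ≤ 26 * ρ := by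
      have h0 : (0 : ℝ) ≤ 2 * ρ / a + 1 := by positivity
      calc 4 * (2 * ρ / a + 1) * (1 / a + 1) ≤ 4 * (147 / 47 * ρ) * (97 / 47) := by
            gcongr
        _ ≤ 26 * ρ := by nlinarith
    have h4 : (0 : ℝ) ≤ (8 * t₀ + 18) * A := by positivity
    nlinarith [mul_le_mul_of_nonneg_right h3 h4]
  · obtain ⟨q, hq, rfl⟩ := Finset.mem_image.1 hij
    obtain ⟨h1, h2⟩ := hS q hq
    rw [← h1]
    calc √((barlowPos a h s q.1 q.2.1 q.2.2 0 - barlowPos a h s q₁ i₀ j₀ 0) ^ 2 +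
          (barlowPos a h s q.1 q.2.1 q.2.2 1 - barlowPos a h s q₁ i₀ j₀ 1) ^ 2)
        ≤ √(ρ ^ 2) := Real.sqrt_le_sqrt h2
      _ = ρ := Real.sqrt_sq hρ0
  · obtain ⟨q, hq, rfl⟩ := Finset.mem_image.1 hij
    obtain ⟨h1, -⟩ := hS q hq
    have := hg q hq
    rw [← h1]
    exact this

end Summit.AtomisticToContinuum.Crystallization.Theorems.SquareWellLayerCake.StackingFaultSparsity

end
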